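import Mathlib
import HarnessLib
import Literature.Analysis.FluidPDE.ClassicalSolution
import Literature.Analysis.FluidPDE.ClassicalSolutionCalculus
import Literature.Analysis.FluidPDE.ClassicalSolutionProofs
import Literature.Analysis.FluidPDE.RapidDecayLemmas
import Literature.Analysis.FluidPDE.NSVorticityHelicityProofs
import Literature.Analysis.FluidPDE.HydrodynamicImpulse
import Literature.Analysis.FluidPDE.HydrodynamicImpulseVector
import Literature.Analysis.FluidPDE.VectorCalculus
import Literature.Analysis.FluidPDE.Vorticity
import Literature.Analysis.FluidPDE.VorticityEquation
import Literature.Analysis.FluidPDE.WholeSpaceIBP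
import Literature.Analysis.FluidPDE.PineauVicolEnstrophy
import Literature.Analysis.FluidPDE.LocalBiotSavartCalculus
import Literature.Analysis.FluidPDE.NewtonKernel
import Literature.Analysis.FluidPDE.LeiZhang2011Cutoff
import Literature.Analysis.FluidPDE.TaoEnstrophyLocalisation
import Literature.Analysis.FluidPDE.EnergyToolkit
import Literature.Analysis.FluidPDE.EnergyUniqueness
import Literature.Analysis.FluidPDE.VorticityCalculus
import Literature.Analysis.FluidPDE.VectorCalculusProofs
import Literature.Analysis.FluidPDE.LeiZhang2011Proofs

/-!
# Period moment laws of the rescaled Euler–Leray system, III-a: ANGULAR-IMPULSE tools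
  (for item stmt-NavierStokesRegularity-1419, `EulerMelnikovDss.PeriodMomentLaws`, law (ii))

Law (ii) of the item, `d/dσ ∫ |y|² curl W(σ) dy = (3ε/2) ∫ |y|² curl W(σ) dy` for the rescaled
Euler–Leray system, is the angular-impulse law `A' = (3ε/2) A`, `A = ∫ y × W`, in disguise
(`∫ |y|² curl V = −2 ∫ y × V`). This file supplies the whole-space integration-by-parts identities it
rests on, each obtained from an explicit flux field `G` with `‖G‖/(1+|y|) ∈ L¹` and the tree's
`PineauVicol2026.integral_divergence_eq_zero_of_integrable_div` (the pattern of the tree's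
`HydrodynamicImpulseVector.lean`), for `C¹` fields `V` with `‖V‖, ‖DV‖ ≤ C(1 + |y|)⁻⁶`:

* pointwise: `div(|y|²(V × eᵢ)) = |y|²(curl V)ᵢ + 2(y × V)ᵢ` (`divergence_normSq_smul_cross_eq`),
  `div((y × V)ᵢ V) = (y × DV V)ᵢ + (y × V)ᵢ div V` (`divergence_cross_apply_smul_eq`),
  `div((y × V)ᵢ y) = (y × DV y)ᵢ + 4 (y × V)ᵢ` (`divergence_cross_apply_smul_id_eq`);
* integrated: `∫ |y|² (curl V)ᵢ = −2 ∫ (y × V)ᵢ` (`integral_normSq_mul_curl_apply`),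
  `∫ (y × DV·V)ᵢ = 0` for `div V = 0` (`integral_cross_convect_apply_eq_zero`),
  `∫ (y × DV·y)ᵢ = −4 ∫ (y × V)ᵢ` (`integral_cross_fderiv_apply_self_eq`).

The viscous and pressure terms and the law itself are in part III-b
(`EulerMelnikovDssPeriodMomentLawsAngularImpulse.lean`).

HONEST FRAMING: calculus identities about HYPOTHETICAL smooth rapidly decaying fields (putative
self-similar-variable blow-up profiles); nothing here bears on NS regularity.

References: P. G. Saffman, *Vortex Dynamics* (1992), §3.2 (3.2.11), §3.5 (angular impulse)
[cite: Saffman1992, §3.5]; A. J. Majda, A. L. Bertozzi, *Vorticity and Incompressible Flow* (2002),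
§1.7 Prop. 1.12 [cite: MajdaBertozziCUP2002, §1.7 Prop. 1.12].
-/

noncomputable section

set_option linter.dupNamespace false

namespace Summit.NavierStokesRegularity.NavierStokesRegularity.Theorems

namespace PeriodMomentLaws

open MeasureTheory Set Filter Topology InnerProductSpace Literature.Analysis.FluidPDE
open scoped RealInnerProductSpace NNReal ENNReal ContDiff Laplacian

/-! ### Pointwise algebra and weight lemmas -/

/-- The `i`-th component map is `C^n` along a `C^n` field (copy of the tree's
`contDiff_apply_coord_vec3` pattern, stated through `EuclideanSpace.proj`). [folklore] -/
theorem hasFDerivAt_coord {v : EuclideanSpace ℝ (Fin 3) → EuclideanSpace ℝ (Fin 3)}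
    {x : EuclideanSpace ℝ (Fin 3)} (hv : DifferentiableAt ℝ v x) (i : Fin 3) :
    HasFDerivAt (fun y => v y i)
      ((EuclideanSpace.proj i : EuclideanSpace ℝ (Fin 3) →L[ℝ] ℝ).comp (fderiv ℝ v x)) x :=
  (EuclideanSpace.proj i : EuclideanSpace ℝ (Fin 3) →L[ℝ] ℝ).hasFDerivAt.comp x hv.hasFDerivAt

/-- The angular-momentum density component `φᵢ(y) = (y × V(y))ᵢ` is differentiable, with
`Dφᵢ(x) h = (h × V(x) + x × DV(x) h)ᵢ` (product rule for the cross product, tree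
`hasFDerivAt_cross`). [folklore] -/
theorem hasFDerivAt_cross_id_apply {V : EuclideanSpace ℝ (Fin 3) → EuclideanSpace ℝ (Fin 3)}
    {x : EuclideanSpace ℝ (Fin 3)} (hV : DifferentiableAt ℝ V x) (i : Fin 3) :
    HasFDerivAt (fun y => cross y (V y) i)
      ((EuclideanSpace.proj i : EuclideanSpace ℝ (Fin 3) →L[ℝ] ℝ).comp
        (crossCLM.precompR (EuclideanSpace ℝ (Fin 3)) x (fderiv ℝ V x) +
          crossCLM.precompL (EuclideanSpace ℝ (Fin 3))
            (ContinuousLinearMap.id ℝ (EuclideanSpace ℝ (Fin 3))) (V x))) x :=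
  (EuclideanSpace.proj i : EuclideanSpace ℝ (Fin 3) →L[ℝ] ℝ).hasFDerivAt.comp x
    (hasFDerivAt_cross (hasFDerivAt_id x) hV.hasFDerivAt)

/-- **Flux identity for the second moment of the curl.** For `V` differentiable at `x` and
`i ∈ {0,1,2}`: `div(|y|² (V × eᵢ))(x) = |x|² (curl V(x))ᵢ + 2 (x × V(x))ᵢ`. [folklore] -/
theorem divergence_normSq_smul_cross_eq {V : EuclideanSpace ℝ (Fin 3) → EuclideanSpace ℝ (Fin 3)}
    {x : EuclideanSpace ℝ (Fin 3)} (hV : DifferentiableAt ℝ V x) (i : Fin 3) :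
    VectorCalculus.divergence (fun y : EuclideanSpace ℝ (Fin 3) =>
        (‖y‖ ^ 2) • cross (V y) (EuclideanSpace.single i (1 : ℝ))) x =
      ‖x‖ ^ 2 * curl V x i + 2 * cross x (V x) i := by
  have h1 : HasFDerivAt (fun y : EuclideanSpace ℝ (Fin 3) => ‖y‖ ^ 2) ((2 : ℝ) • innerSL ℝ x) x := by
    have h := (hasStrictFDerivAt_norm_sq x).hasFDerivAt
    rw [← Nat.cast_smul_eq_nsmul ℝ] at h
    simpa only [Nat.cast_ofNat] using h
  have h2 : HasFDerivAt (fun y : EuclideanSpace ℝ (Fin 3) => cross (V y) (EuclideanSpace.single i (1 : ℝ)))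
      _ x := hasFDerivAt_cross hV.hasFDerivAt (hasFDerivAt_const (EuclideanSpace.single i (1 : ℝ)) x)
  have hG : HasFDerivAt (fun y : EuclideanSpace ℝ (Fin 3) =>
      (‖y‖ ^ 2) • cross (V y) (EuclideanSpace.single i (1 : ℝ))) _ x := h1.smul h2
  rw [divergence_eq_sum_inner_fderiv (EuclideanSpace.basisFun (Fin 3) ℝ), hG.fderiv]
  have hn : ‖x‖ ^ 2 = x 0 * x 0 + x 1 * x 1 + x 2 * x 2 := by
    rw [← real_inner_self_eq_norm_sq, PiLp.inner_apply]
    simp [Fin.sum_univ_three]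
    ring
  fin_cases i <;>
    simp [Fin.sum_univ_three, inner_add_right, inner_smul_right, cross, cross_apply,
      Literature.Analysis.FluidPDE.curl, PiLp.inner_apply, innerSL_apply_apply, hn] <;> ring

/-- **Flux identity for the transport term.** For `V` differentiable at `x` and `i ∈ {0,1,2}`:
`div((y × V(y))ᵢ V)(x) = (x × DV(x) V(x))ᵢ + (x × V(x))ᵢ div V(x)`. [folklore] -/
theorem divergence_cross_apply_smul_eq {V : EuclideanSpace ℝ (Fin 3) → EuclideanSpace ℝ (Fin 3)}
    {x : EuclideanSpace ℝ (Fin 3)} (hV : DifferentiableAt ℝ V x) (i : Fin 3) :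
    VectorCalculus.divergence (fun y : EuclideanSpace ℝ (Fin 3) => (cross y (V y) i) • V y) x =
      cross x (fderiv ℝ V x (V x)) i + cross x (V x) i * VectorCalculus.divergence V x := by
  have hφ := hasFDerivAt_cross_id_apply hV i
  rw [divergence_smul_apply hφ.differentiableAt hV, gradient, real_inner_comm,
    InnerProductSpace.toDual_symm_apply, hφ.fderiv]
  simp only [ContinuousLinearMap.coe_comp, Function.comp_apply, _root_.add_apply,
    ContinuousLinearMap.precompR_apply, ContinuousLinearMap.precompL_apply,
    ContinuousLinearMap.coe_id', id_eq, crossCLM_apply]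
  fin_cases i <;> simp [cross, cross_apply] <;> ring

/-- **Flux identity for the similarity drift.** For `V` differentiable at `x` and `i ∈ {0,1,2}`:
`div((y × V(y))ᵢ y)(x) = (x × DV(x) x)ᵢ + 4 (x × V(x))ᵢ`. [folklore] -/
theorem divergence_cross_apply_smul_id_eq {V : EuclideanSpace ℝ (Fin 3) → EuclideanSpace ℝ (Fin 3)}
    {x : EuclideanSpace ℝ (Fin 3)} (hV : DifferentiableAt ℝ V x) (i : Fin 3) :
    VectorCalculus.divergence (fun y : EuclideanSpace ℝ (Fin 3) => (cross y (V y) i) • y) x =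
      cross x (fderiv ℝ V x x) i + 4 * cross x (V x) i := by
  have hφ := hasFDerivAt_cross_id_apply hV i
  have hdiv3 : VectorCalculus.divergence (fun y : EuclideanSpace ℝ (Fin 3) => y) x = 3 := by
    rw [divergence_eq_sum_inner_fderiv (stdOrthonormalBasis ℝ (EuclideanSpace ℝ (Fin 3)))]
    have e : fderiv ℝ (fun y : EuclideanSpace ℝ (Fin 3) => y) x = ContinuousLinearMap.id ℝ _ := fderiv_id
    simp only [e, ContinuousLinearMap.id_apply, real_inner_self_eq_norm_sq,
      (stdOrthonormalBasis ℝ (EuclideanSpace ℝ (Fin 3))).orthonormal.1, one_pow, Finset.sum_const,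
      Finset.card_univ, nsmul_eq_mul, mul_one]
    rw [← Module.finrank_eq_card_basis (stdOrthonormalBasis ℝ (EuclideanSpace ℝ (Fin 3))).toBasis]
    simp
  rw [divergence_smul_apply hφ.differentiableAt differentiableAt_fun_id, hdiv3, gradient, real_inner_comm,
    InnerProductSpace.toDual_symm_apply, hφ.fderiv]
  simp only [ContinuousLinearMap.coe_comp, Function.comp_apply, _root_.add_apply,
    ContinuousLinearMap.precompR_apply, ContinuousLinearMap.precompL_apply,
    ContinuousLinearMap.coe_id', id_eq, crossCLM_apply]
  fin_cases i <;> simp [cross, cross_apply] <;> ring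

/-! ### Weights and integrability -/

/-- Weight algebra: `‖x‖ᵏ (1 + ‖x‖)^{-a} ≤ (1 + ‖x‖)^{-(a-k)}`. [folklore] -/
theorem norm_pow_mul_rpow_neg_le (x : EuclideanSpace ℝ (Fin 3)) (k : ℕ) (a : ℝ) :
    ‖x‖ ^ k * (1 + ‖x‖) ^ (-a) ≤ (1 + ‖x‖) ^ (-(a - k)) := by
  have h0 : 0 < 1 + ‖x‖ := by positivity
  have h1 : ‖x‖ ^ k ≤ (1 + ‖x‖) ^ (k : ℝ) := by
    rw [Real.rpow_natCast]
    exact pow_le_pow_left₀ (norm_nonneg _) (by linarith [norm_nonneg x]) k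
  calc ‖x‖ ^ k * (1 + ‖x‖) ^ (-a) ≤ (1 + ‖x‖) ^ (k : ℝ) * (1 + ‖x‖) ^ (-a) := by
        gcongr
    _ = (1 + ‖x‖) ^ (-(a - k)) := by rw [← Real.rpow_add h0]; congr 1; ring

/-- `dim ℝ³ = 3 < 4`, in the form the integrability lemmas want. [folklore] -/
theorem finrank_three_lt_four : (Module.finrank ℝ (EuclideanSpace ℝ (Fin 3)) : ℝ) < 4 := by
  rw [finrank_euclideanSpace_fin]; norm_num

/-- A continuous function with `‖g x‖ ≤ C ‖x‖ᵏ (1 + ‖x‖)^{-a}`, `a - k ≥ 4`, is integrable on `ℝ³`.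
[folklore] -/
theorem integrable_of_norm_le_pow_mul_rpow {G : Type*} [NormedAddCommGroup G]
    {g : EuclideanSpace ℝ (Fin 3) → G} (hg : Continuous g) {C a : ℝ} {k : ℕ} (hC : 0 ≤ C)
    (ha : 4 ≤ a - k) (h : ∀ x, ‖g x‖ ≤ C * (‖x‖ ^ k * (1 + ‖x‖) ^ (-a))) :
    Integrable g (volume : Measure (EuclideanSpace ℝ (Fin 3))) := by
  refine integrable_of_norm_le_rpow_neg hg (C := C) (r := 4) finrank_three_lt_four fun x => ?_
  refine (h x).trans ?_
  have h0 : 0 < 1 + ‖x‖ := by positivity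
  have h1 : (1 : ℝ) ≤ 1 + ‖x‖ := by linarith [norm_nonneg x]
  calc C * (‖x‖ ^ k * (1 + ‖x‖) ^ (-a)) ≤ C * (1 + ‖x‖) ^ (-(a - k)) :=
        mul_le_mul_of_nonneg_left (norm_pow_mul_rpow_neg_le x k a) hC
    _ ≤ C * (1 + ‖x‖) ^ (-(4 : ℝ)) :=
        mul_le_mul_of_nonneg_left (Real.rpow_le_rpow_of_exponent_le h1 (by linarith)) hC

/-! ### The five whole-space identities -/

section Identities

variable {V : EuclideanSpace ℝ (Fin 3) → EuclideanSpace ℝ (Fin 3)} {C : ℝ}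

/-- **`∫ |y|² curl V = −2 ∫ y × V`** (componentwise) for a `C¹` field with
`‖V‖, ‖DV‖ ≤ C (1 + ‖y‖)⁻⁶`: the flux `|y|² (V × eᵢ)` has divergence `|y|²(curl V)ᵢ + 2(y × V)ᵢ`
(`divergence_normSq_smul_cross_eq`) and `‖flux‖/(1+|y|) ∈ L¹`, so its divergence integrates to zero
(tree `PineauVicol2026.integral_divergence_eq_zero_of_integrable_div`). [cite: Saffman1992, §3.5] -/
theorem integral_normSq_mul_curl_apply (hV : ContDiff ℝ 1 V) (hC : 0 ≤ C)
    (h0 : ∀ y, ‖V y‖ ≤ C * (1 + ‖y‖) ^ (-(6 : ℝ)))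
    (h1 : ∀ y, ‖fderiv ℝ V y‖ ≤ C * (1 + ‖y‖) ^ (-(6 : ℝ))) (i : Fin 3) :
    ∫ y, ‖y‖ ^ 2 * curl V y i = -2 * ∫ y, cross y (V y) i := by
  set e : EuclideanSpace ℝ (Fin 3) := EuclideanSpace.single i (1 : ℝ) with he
  have hen : ‖e‖ = 1 := by simp [he]
  set G : EuclideanSpace ℝ (Fin 3) → EuclideanSpace ℝ (Fin 3) := fun y => (‖y‖ ^ 2) • cross (V y) e
    with hGdef
  have hVc : Continuous V := hV.continuous
  have hcr : ContDiff ℝ 1 (fun y => cross (V y) e) := by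
    have h := (crossCLM.flip e).contDiff.comp hV
    simpa [Function.comp_def] using h
  have hG1 : ContDiff ℝ 1 G := (contDiff_norm_sq ℝ).smul hcr
  have hdiv : (fun x => VectorCalculus.divergence G x) =
      fun x => ‖x‖ ^ 2 * curl V x i + 2 * cross x (V x) i :=
    funext fun x => divergence_normSq_smul_cross_eq ((hV.differentiable one_ne_zero) x) i
  -- integrability of the two pieces of the divergence
  have hA : Integrable (fun x : EuclideanSpace ℝ (Fin 3) => ‖x‖ ^ 2 * curl V x i) := by
    refine integrable_of_norm_le_pow_mul_rpow ((continuous_norm.pow 2).mul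
      ((continuous_apply i).comp (PiLp.continuous_ofLp 2 _) |>.comp (continuous_curl hV)))
      (C := ‖curlCLM‖ * C) (k := 2) (a := 6) (by positivity) (by norm_num) fun x => ?_
    rw [norm_mul, norm_pow, norm_norm]
    have hc : |curl V x i| ≤ ‖curl V x‖ := by simpa using PiLp.norm_apply_le (curl V x) i
    calc ‖x‖ ^ 2 * ‖curl V x i‖ ≤ ‖x‖ ^ 2 * (‖curlCLM‖ * (C * (1 + ‖x‖) ^ (-(6 : ℝ)))) := by
          rw [Real.norm_eq_abs]
          exact mul_le_mul_of_nonneg_left (hc.trans ((norm_curl_le V x).trans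
            (mul_le_mul_of_nonneg_left (h1 x) (ContinuousLinearMap.opNorm_nonneg curlCLM))))
            (sq_nonneg _)
      _ = ‖curlCLM‖ * C * (‖x‖ ^ 2 * (1 + ‖x‖) ^ (-(6 : ℝ))) := by ring
  have hB : Integrable (fun x : EuclideanSpace ℝ (Fin 3) => cross x (V x) i) := by
    refine integrable_of_norm_le_pow_mul_rpow
      ((continuous_apply i).comp (PiLp.continuous_ofLp 2 _) |>.comp
        (crossCLM.continuous₂.comp (continuous_id.prodMk hVc)))
      (C := C) (k := 1) (a := 6) hC (by norm_num) fun x => ?_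
    have hc : |cross x (V x) i| ≤ ‖cross x (V x)‖ := by simpa using PiLp.norm_apply_le (cross x (V x)) i
    rw [Real.norm_eq_abs]
    calc |cross x (V x) i| ≤ ‖x‖ * ‖V x‖ := hc.trans (norm_cross_le_norm_mul_norm _ _)
      _ ≤ ‖x‖ * (C * (1 + ‖x‖) ^ (-(6 : ℝ))) := by gcongr; exact h0 x
      _ = C * (‖x‖ ^ 1 * (1 + ‖x‖) ^ (-(6 : ℝ))) := by ring
  have hdI : Integrable fun x => VectorCalculus.divergence G x := by
    rw [hdiv]; exact hA.add (hB.const_mul 2)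
  have hwI : Integrable fun x => ‖G x‖ / (1 + ‖x‖) := by
    refine integrable_of_norm_le_pow_mul_rpow ((hG1.continuous.norm).div
      (continuous_const.add continuous_norm) fun x => (by positivity : (1 : ℝ) + ‖x‖ ≠ 0))
      (C := C) (k := 1) (a := 6) hC (by norm_num) fun x => ?_
    have hx0 : 0 < 1 + ‖x‖ := by positivity
    rw [Real.norm_of_nonneg (by positivity), div_le_iff₀ hx0, hGdef]
    simp only
    rw [norm_smul, norm_pow, norm_norm]
    calc ‖x‖ ^ 2 * ‖cross (V x) e‖ ≤ ‖x‖ ^ 2 * (‖V x‖ * ‖e‖) := by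
          gcongr; exact norm_cross_le_norm_mul_norm _ _
      _ ≤ ‖x‖ ^ 2 * (C * (1 + ‖x‖) ^ (-(6 : ℝ))) := by rw [hen, mul_one]; gcongr; exact h0 x
      _ ≤ C * (‖x‖ ^ 1 * (1 + ‖x‖) ^ (-(6 : ℝ))) * (1 + ‖x‖) := by
          rw [pow_one]
          have : ‖x‖ ^ 2 ≤ ‖x‖ * (1 + ‖x‖) := by nlinarith [norm_nonneg x]
          have hw : 0 ≤ C * (1 + ‖x‖) ^ (-(6 : ℝ)) := by positivity
          nlinarith
  have h := PineauVicol2026.integral_divergence_eq_zero_of_integrable_div hG1 hwI hdI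
  rw [hdiv, integral_add hA (hB.const_mul 2), integral_const_mul] at h
  linarith

/-- **`∫ y × (DV·V) = 0`** (componentwise) for a divergence-free `C¹` field with
`‖V‖, ‖DV‖ ≤ C (1 + ‖y‖)⁻⁶`: the flux `(y × V)ᵢ V` (`divergence_cross_apply_smul_eq`).
[cite: MajdaBertozziCUP2002, §1.7 Prop. 1.12] -/
theorem integral_cross_convect_apply_eq_zero (hV : ContDiff ℝ 1 V) (hdiv : VectorCalculus.IsDivFree V)
    (hC : 0 ≤ C) (h0 : ∀ y, ‖V y‖ ≤ C * (1 + ‖y‖) ^ (-(6 : ℝ)))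
    (h1 : ∀ y, ‖fderiv ℝ V y‖ ≤ C * (1 + ‖y‖) ^ (-(6 : ℝ))) (i : Fin 3) :
    ∫ y, cross y (fderiv ℝ V y (V y)) i = 0 := by
  set G : EuclideanSpace ℝ (Fin 3) → EuclideanSpace ℝ (Fin 3) := fun y => (cross y (V y) i) • V y
    with hGdef
  have hVc : Continuous V := hV.continuous
  have hDVc : Continuous (fderiv ℝ V) := hV.continuous_fderiv one_ne_zero
  have hφ : ContDiff ℝ 1 (fun y : EuclideanSpace ℝ (Fin 3) => cross y (V y) i) :=
    contDiff_apply_coord_vec3 (crossCLM.contDiff.clm_apply hV) i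
  have hG1 : ContDiff ℝ 1 G := hφ.smul hV
  have hdivG : (fun x => VectorCalculus.divergence G x) = fun x => cross x (fderiv ℝ V x (V x)) i := by
    funext x
    rw [hGdef, divergence_cross_apply_smul_eq ((hV.differentiable one_ne_zero) x) i, hdiv x,
      mul_zero, add_zero]
  have hC1 : C * (1 + ‖(0 : EuclideanSpace ℝ (Fin 3))‖) ^ (-(6 : ℝ)) ≤ C := by
    simp
  have hA : Integrable (fun x : EuclideanSpace ℝ (Fin 3) => cross x (fderiv ℝ V x (V x)) i) := by
    refine integrable_of_norm_le_pow_mul_rpow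
      ((continuous_apply i).comp (PiLp.continuous_ofLp 2 _) |>.comp
        (crossCLM.continuous₂.comp (continuous_id.prodMk (hDVc.clm_apply hVc))))
      (C := C * C) (k := 1) (a := 6) (by positivity) (by norm_num) fun x => ?_
    have hc : |cross x (fderiv ℝ V x (V x)) i| ≤ ‖cross x (fderiv ℝ V x (V x))‖ := by
      simpa using PiLp.norm_apply_le (cross x (fderiv ℝ V x (V x))) i
    have hVx : ‖V x‖ ≤ C := (h0 x).trans (by
      have h1' : (1 + ‖x‖) ^ (-(6 : ℝ)) ≤ 1 :=
        Real.rpow_le_one_of_one_le_of_nonpos (by linarith [norm_nonneg x]) (by norm_num)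
      nlinarith)
    rw [Real.norm_eq_abs, pow_one]
    calc |cross x (fderiv ℝ V x (V x)) i| ≤ ‖x‖ * ‖fderiv ℝ V x (V x)‖ := hc.trans (norm_cross_le_norm_mul_norm _ _)
      _ ≤ ‖x‖ * (‖fderiv ℝ V x‖ * ‖V x‖) := by gcongr; exact ContinuousLinearMap.le_opNorm _ _
      _ ≤ ‖x‖ * ((C * (1 + ‖x‖) ^ (-(6 : ℝ))) * C) := by gcongr; exact h1 x
      _ = C * C * (‖x‖ * (1 + ‖x‖) ^ (-(6 : ℝ))) := by ring
  have hdI : Integrable fun x => VectorCalculus.divergence G x := by rw [hdivG]; exact hA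
  have hwI : Integrable fun x => ‖G x‖ / (1 + ‖x‖) := by
    refine integrable_of_norm_le_pow_mul_rpow ((hG1.continuous.norm).div
      (continuous_const.add continuous_norm) fun x => (by positivity : (1 : ℝ) + ‖x‖ ≠ 0))
      (C := C * C) (k := 0) (a := 6) (by positivity) (by norm_num) fun x => ?_
    have hx0 : 0 < 1 + ‖x‖ := by positivity
    have hVx : ‖V x‖ ≤ C := (h0 x).trans (by
      have h1' : (1 + ‖x‖) ^ (-(6 : ℝ)) ≤ 1 :=
        Real.rpow_le_one_of_one_le_of_nonpos (by linarith [norm_nonneg x]) (by norm_num)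
      nlinarith)
    have hc : |cross x (V x) i| ≤ ‖cross x (V x)‖ := by simpa using PiLp.norm_apply_le (cross x (V x)) i
    rw [Real.norm_of_nonneg (by positivity), div_le_iff₀ hx0, hGdef]
    simp only
    rw [norm_smul, Real.norm_eq_abs, pow_zero, one_mul]
    calc |cross x (V x) i| * ‖V x‖ ≤ (‖x‖ * ‖V x‖) * ‖V x‖ := by
          gcongr; exact hc.trans (norm_cross_le_norm_mul_norm _ _)
      _ ≤ (‖x‖ * (C * (1 + ‖x‖) ^ (-(6 : ℝ)))) * C := by gcongr; exact h0 x
      _ ≤ C * C * (1 + ‖x‖) ^ (-(6 : ℝ)) * (1 + ‖x‖) := by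
          have hw : 0 ≤ C * C * (1 + ‖x‖) ^ (-(6 : ℝ)) := by positivity
          nlinarith [norm_nonneg x]
  have h := PineauVicol2026.integral_divergence_eq_zero_of_integrable_div hG1 hwI hdI
  rwa [hdivG] at h

/-- **`∫ y × (DV·y) = −4 ∫ y × V`** (componentwise) for a `C¹` field with
`‖V‖, ‖DV‖ ≤ C (1 + ‖y‖)⁻⁶`: the flux `(y × V)ᵢ y` (`divergence_cross_apply_smul_id_eq`).
[folklore] -/
theorem integral_cross_fderiv_apply_self_eq (hV : ContDiff ℝ 1 V) (hC : 0 ≤ C)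
    (h0 : ∀ y, ‖V y‖ ≤ C * (1 + ‖y‖) ^ (-(6 : ℝ)))
    (h1 : ∀ y, ‖fderiv ℝ V y‖ ≤ C * (1 + ‖y‖) ^ (-(6 : ℝ))) (i : Fin 3) :
    ∫ y, cross y (fderiv ℝ V y y) i = -4 * ∫ y, cross y (V y) i := by
  set G : EuclideanSpace ℝ (Fin 3) → EuclideanSpace ℝ (Fin 3) := fun y => (cross y (V y) i) • y
    with hGdef
  have hVc : Continuous V := hV.continuous
  have hDVc : Continuous (fderiv ℝ V) := hV.continuous_fderiv one_ne_zero
  have hφ : ContDiff ℝ 1 (fun y : EuclideanSpace ℝ (Fin 3) => cross y (V y) i) :=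
    contDiff_apply_coord_vec3 (crossCLM.contDiff.clm_apply hV) i
  have hG1 : ContDiff ℝ 1 G := hφ.smul contDiff_id
  have hdivG : (fun x => VectorCalculus.divergence G x) =
      fun x => cross x (fderiv ℝ V x x) i + 4 * cross x (V x) i :=
    funext fun x => divergence_cross_apply_smul_id_eq ((hV.differentiable one_ne_zero) x) i
  have hA : Integrable (fun x : EuclideanSpace ℝ (Fin 3) => cross x (fderiv ℝ V x x) i) := by
    refine integrable_of_norm_le_pow_mul_rpow
      ((continuous_apply i).comp (PiLp.continuous_ofLp 2 _) |>.comp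
        (crossCLM.continuous₂.comp (continuous_id.prodMk (hDVc.clm_apply continuous_id))))
      (C := C) (k := 2) (a := 6) hC (by norm_num) fun x => ?_
    have hc : |cross x (fderiv ℝ V x x) i| ≤ ‖cross x (fderiv ℝ V x x)‖ := by
      simpa using PiLp.norm_apply_le (cross x (fderiv ℝ V x x)) i
    rw [Real.norm_eq_abs]
    calc |cross x (fderiv ℝ V x x) i| ≤ ‖x‖ * ‖fderiv ℝ V x x‖ := hc.trans (norm_cross_le_norm_mul_norm _ _)
      _ ≤ ‖x‖ * (‖fderiv ℝ V x‖ * ‖x‖) := by gcongr; exact ContinuousLinearMap.le_opNorm _ _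
      _ ≤ ‖x‖ * ((C * (1 + ‖x‖) ^ (-(6 : ℝ))) * ‖x‖) := by gcongr; exact h1 x
      _ = C * (‖x‖ ^ 2 * (1 + ‖x‖) ^ (-(6 : ℝ))) := by ring
  have hB : Integrable (fun x : EuclideanSpace ℝ (Fin 3) => cross x (V x) i) := by
    refine integrable_of_norm_le_pow_mul_rpow
      ((continuous_apply i).comp (PiLp.continuous_ofLp 2 _) |>.comp
        (crossCLM.continuous₂.comp (continuous_id.prodMk hVc)))
      (C := C) (k := 1) (a := 6) hC (by norm_num) fun x => ?_
    have hc : |cross x (V x) i| ≤ ‖cross x (V x)‖ := by simpa using PiLp.norm_apply_le (cross x (V x)) i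
    rw [Real.norm_eq_abs]
    calc |cross x (V x) i| ≤ ‖x‖ * ‖V x‖ := hc.trans (norm_cross_le_norm_mul_norm _ _)
      _ ≤ ‖x‖ * (C * (1 + ‖x‖) ^ (-(6 : ℝ))) := by gcongr; exact h0 x
      _ = C * (‖x‖ ^ 1 * (1 + ‖x‖) ^ (-(6 : ℝ))) := by ring
  have hdI : Integrable fun x => VectorCalculus.divergence G x := by
    rw [hdivG]; exact hA.add (hB.const_mul 4)
  have hwI : Integrable fun x => ‖G x‖ / (1 + ‖x‖) := by
    refine integrable_of_norm_le_pow_mul_rpow ((hG1.continuous.norm).div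
      (continuous_const.add continuous_norm) fun x => (by positivity : (1 : ℝ) + ‖x‖ ≠ 0))
      (C := C) (k := 1) (a := 6) hC (by norm_num) fun x => ?_
    have hx0 : 0 < 1 + ‖x‖ := by positivity
    have hc : |cross x (V x) i| ≤ ‖cross x (V x)‖ := by simpa using PiLp.norm_apply_le (cross x (V x)) i
    rw [Real.norm_of_nonneg (by positivity), div_le_iff₀ hx0, hGdef]
    simp only
    rw [norm_smul, Real.norm_eq_abs, pow_one]
    calc |cross x (V x) i| * ‖x‖ ≤ (‖x‖ * ‖V x‖) * ‖x‖ := by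
          gcongr; exact hc.trans (norm_cross_le_norm_mul_norm _ _)
      _ ≤ (‖x‖ * (C * (1 + ‖x‖) ^ (-(6 : ℝ)))) * ‖x‖ := by gcongr; exact h0 x
      _ ≤ C * (‖x‖ * (1 + ‖x‖) ^ (-(6 : ℝ))) * (1 + ‖x‖) := by
          have hw : 0 ≤ C * (1 + ‖x‖) ^ (-(6 : ℝ)) := by positivity
          nlinarith [norm_nonneg x]
  have h := PineauVicol2026.integral_divergence_eq_zero_of_integrable_div hG1 hwI hdI
  rw [hdivG, integral_add hA (hB.const_mul 4), integral_const_mul] at h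
  linarith

end Identities

end PeriodMomentLaws

end Summit.NavierStokesRegularity.NavierStokesRegularity.Theorems

end
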